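import Mathlib
import HarnessLib
import Literature.Analysis.FluidPDE.TaoAveragedNondegeneracy
import Literature.Analysis.FluidPDE.VectorCalculus
import Summits.NavierStokesRegularity.NavierStokesRegularity.Theorems.UnthreadedDoorNetFluxLevelChart

/-!
# Route `UnthreadedDoor` / `ThreadingFlux`, crux `PoloidalLiouville` (stmt-NavierStokesRegularity-1222), WALL W1 —
# registered stub (2a′) `stub_levelSetLocalLaw` of the «antidynamo v2» skeleton: the LEVEL-SET-LOCAL REACTION LAW

Prover file (seat ns-wall-eng-7 g5, cell ns-wall-extremal; `--supports stmt-NavierStokesRegularity-1222`, registered stub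
`stub_levelSetLocalLaw : StubLevelSetLocalLaw` of the skeleton `PoloidalLiouville_antidynamo_birth_v2.lean` (planner ns-idea-6 g5),
signature VERBATIM).  Statement (constant-rank step of the intended (2b) attack, PLAN-ONLY in the composition): off the critical set —
at a point `x₁ ≠ x₀` of an open set `U` where `∇T(x₁) × (x₁ − x₀) ≠ 0` — the loop first integral `det[x − x₀, ∇m, ∇T] = 0` on `U`
makes the radial momentum LOCALLY a smooth function of the potential and the radius: `m = M(T, ‖x − x₀‖)` on a neighbourhood
`V ∋ x₁`, `M ∈ C^∞(ℝ²)`.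

Proof (the chart of `UnthreadedDoorNetFluxLevelChart`, now in three variables and `C^∞`): the inverse function theorem
(`ContDiffAt.toOpenPartialHomeomorph`) for `F(x) = (‖x − x₀‖², T x, ⟪ℓ, x − x₀⟫)`, `ℓ = ∇T(x₁) × (x₁ − x₀)`, whose derivative is
injective where the triple product `⟪(x − x₀) × ∇T(x), ℓ⟫ ≠ 0` (`NetFlux.injective_chartDeriv`); in the chart
`N(q, c, u) = m(F⁻¹(q, c, u))` has `∂_u N = ⟪∇m, τ_u⟫ = 0` because the fibre direction `τ_u` is orthogonal to `x − x₀` and to `∇T`,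
hence parallel to `∇T × (x − x₀)`, and `⟪∇m, ∇T × (x − x₀)⟫ = −⟪x − x₀, ∇m × ∇T⟫ = 0` (the hypothesis); the mean value inequality in
`u` gives `N(q, c, u) = N(q, c, 0)`, a `C^∞` function of `(q, c)` near `(‖x₁ − x₀‖², T x₁)` (`OpenPartialHomeomorph.contDiffAt_symm`
at every point of a small ball), globalised to `ℝ²` by a product of two bump functions equal to `1` near that point; finally
`M(a, b) := M₂(b², a)`.  CRITICAL-SET CAVEAT respected: nothing is claimed where `∇T × (x − x₀) = 0`.

HONEST LABEL: differential calculus (constant-rank theorem in `ℝ³`); it is the registered plan-only stub (2a′), NOT used by the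
composition `PoloidalLiouville_of`; the wall `stub_scalarLiouville`, `PoloidalLiouville` (1222) and NS regularity remain OPEN.  0 kit.
-/

noncomputable section

-- the summit and its single sub-problem share the name (CONVENTIONS §1)
set_option linter.dupNamespace false

open Set Function Filter Topology InnerProductSpace Metric
open scoped RealInnerProductSpace ContDiff

namespace Summit.NavierStokesRegularity.NavierStokesRegularity.Theorems.PoloidalLiouville

open Literature.Analysis Literature.Analysis.FluidPDE NetFlux

section LevelSetLocalLaw

variable {T m : E3 → ℝ} {x₀ : E3} {U : Set E3}

/-- The derivative of the chart `F(x) = (‖x − x₀‖², T x, ⟪ℓ, x − x₀⟫)` at a point where `T` is differentiable. -/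
theorem hasFDerivAt_chart_of_differentiableAt {x : E3} (hT : DifferentiableAt ℝ T x) (ℓ x₀ : E3) :
    HasFDerivAt (fun x : E3 => ((‖x - x₀‖ ^ 2, T x, ⟪ℓ, x - x₀⟫) : ℝ × ℝ × ℝ))
      ((2 • innerSL ℝ (x - x₀)).prod ((fderiv ℝ T x).prod (innerSL ℝ ℓ))) x := by
  have h1 : HasFDerivAt (fun x : E3 => ‖x - x₀‖ ^ 2) (2 • innerSL ℝ (x - x₀)) x := by
    have := (hasStrictFDerivAt_norm_sq (x - x₀)).hasFDerivAt.comp x (hasFDerivAt_sub_const x₀)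
    rw [ContinuousLinearMap.comp_id] at this
    exact this
  have h3 : HasFDerivAt (fun x : E3 => ⟪ℓ, x - x₀⟫) (innerSL ℝ ℓ) x := by
    have := (innerSL ℝ ℓ).hasFDerivAt.comp x (hasFDerivAt_sub_const x₀)
    rw [ContinuousLinearMap.comp_id] at this
    exact this
  exact h1.prodMk (hT.hasFDerivAt.prodMk h3)

/-- The chart is `C^n` at points where `T` is. -/
theorem contDiffAt_chart_of_contDiffAt {n : WithTop ℕ∞} {x : E3} (hT : ContDiffAt ℝ n T x) (ℓ x₀ : E3) :
    ContDiffAt ℝ n (fun x : E3 => ((‖x - x₀‖ ^ 2, T x, ⟪ℓ, x - x₀⟫) : ℝ × ℝ × ℝ)) x := by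
  have h1 : ContDiffAt ℝ n (fun x : E3 => ‖x - x₀‖ ^ 2) x := (contDiffAt_id.sub contDiffAt_const).norm_sq ℝ
  have h3 : ContDiffAt ℝ n (fun x : E3 => ⟪ℓ, x - x₀⟫) x :=
    contDiffAt_const.inner ℝ (contDiffAt_id.sub contDiffAt_const)
  exact h1.prodMk (hT.prodMk h3)

/-- A vector orthogonal to `a` and `b` is orthogonal to every vector orthogonal to `a × b`, when `a × b ≠ 0`
(it is a multiple of `a × b`). -/
theorem inner_eq_zero_of_orthogonal_pair {a b τ g : E3} (hab : cross a b ≠ 0) (ha : ⟪a, τ⟫ = 0) (hb : ⟪b, τ⟫ = 0)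
    (hg : ⟪g, cross a b⟫ = 0) : ⟪g, τ⟫ = 0 := by
  set w : E3 := cross a b with hw
  have hw2 : ⟪w, w⟫ ≠ 0 := by
    rw [real_inner_self_eq_norm_sq]; exact pow_ne_zero 2 (norm_ne_zero_iff.2 hab)
  set μ : ℝ := ⟪w, τ⟫ / ⟪w, w⟫ with hμ
  -- `τ − μ w` is orthogonal to `a`, `b`, `w`, hence zero
  have haw : ⟪a, w⟫ = 0 := by rw [hw, real_inner_comm (cross a b) a]; exact Tao2016.inner_cross_self_left a b
  have hbw : ⟪b, w⟫ = 0 := by rw [hw, real_inner_comm (cross a b) b]; exact Tao2016.inner_cross_self_right a b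
  have habc : ⟪cross a b, w⟫ ≠ 0 := by rw [← hw]; exact hw2
  have h0 : τ - μ • w = 0 := by
    refine eq_zero_of_orthogonal_triple (a := a) (b := b) (c := w) ?_ ?_ ?_ habc
    · rw [inner_sub_right, inner_smul_right, ha, haw, mul_zero, sub_zero]
    · rw [inner_sub_right, inner_smul_right, hb, hbw, mul_zero, sub_zero]
    · rw [inner_sub_right, inner_smul_right, hμ, div_mul_cancel₀ _ hw2, sub_self]
  have hτ : τ = μ • w := sub_eq_zero.1 h0
  rw [hτ, inner_smul_right, hg, mul_zero]

/-- ★ **Registered stub (2a′) `stub_levelSetLocalLaw : StubLevelSetLocalLaw`, signature verbatim** — the LEVEL-SET-LOCAL REACTION LAW: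
off the critical set, the loop first integral `det[x − x₀, ∇m, ∇T] = 0` makes `m` locally a smooth function of `(T, ‖x − x₀‖)`. -/
theorem stub_levelSetLocalLaw :
    ∀ (T m : EuclideanSpace ℝ (Fin 3) → ℝ) (x₀ x₁ : EuclideanSpace ℝ (Fin 3)) (U : Set (EuclideanSpace ℝ (Fin 3))),
    IsOpen U → x₁ ∈ U → x₁ ≠ x₀ → ContDiffOn ℝ (⊤ : ℕ∞) T U → ContDiffOn ℝ (⊤ : ℕ∞) m U →
    Literature.Analysis.FluidPDE.cross (gradient T x₁) (x₁ - x₀) ≠ 0 →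
    (∀ x ∈ U, inner ℝ (x - x₀) (Literature.Analysis.FluidPDE.cross (gradient m x) (gradient T x)) = 0) →
    ∃ V : Set (EuclideanSpace ℝ (Fin 3)), IsOpen V ∧ x₁ ∈ V ∧ V ⊆ U ∧
      ∃ M : ℝ → ℝ → ℝ, ContDiff ℝ (⊤ : ℕ∞) (Function.uncurry M) ∧ ∀ x ∈ V, m x = M (T x) ‖x - x₀‖ := by
  intro T m x₀ z U hUo hzU hz0 hT hm hreg hdet
  classical
  -- the normal `ℓ` to the chart's third coordinate
  set ℓ : E3 := cross (gradient T z) (z - x₀) with hℓ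
  have hℓ0 : ℓ ≠ 0 := hreg
  -- the chart and its derivative field
  set F : E3 → ℝ × ℝ × ℝ := fun x => (‖x - x₀‖ ^ 2, T x, ⟪ℓ, x - x₀⟫) with hF
  set L : E3 → (E3 →L[ℝ] ℝ × ℝ × ℝ) := fun x =>
    (2 • innerSL ℝ (x - x₀)).prod ((fderiv ℝ T x).prod (innerSL ℝ ℓ)) with hL
  have hLapply : ∀ x w, L x w = (2 * ⟪x - x₀, w⟫, fderiv ℝ T x w, ⟪ℓ, w⟫) := by
    intro x w
    simp [hL, inner_sub_left, mul_sub, two_mul]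
  have hTc : ∀ x ∈ U, ContDiffAt ℝ ∞ T x := fun x hx => hT.contDiffAt (hUo.mem_nhds hx)
  have hmc : ∀ x ∈ U, ContDiffAt ℝ ∞ m x := fun x hx => hm.contDiffAt (hUo.mem_nhds hx)
  have hTd : ∀ x ∈ U, DifferentiableAt ℝ T x := fun x hx => (hTc x hx).differentiableAt (by simp)
  have hmd : ∀ x ∈ U, DifferentiableAt ℝ m x := fun x hx => (hmc x hx).differentiableAt (by simp)
  have hFd : ∀ x ∈ U, HasFDerivAt F (L x) x := fun x hx => hasFDerivAt_chart_of_differentiableAt (hTd x hx) ℓ x₀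
  have hFc : ∀ x ∈ U, ContDiffAt ℝ ∞ F x := fun x hx => contDiffAt_chart_of_contDiffAt (hTc x hx) ℓ x₀
  -- the invertibility locus `W₀ ⊆ U`
  set W₀ : Set E3 := {x | x ∈ U ∧ ⟪x - x₀, cross (gradient T x) ℓ⟫ ∈ ({0}ᶜ : Set ℝ)} with hW₀
  have hW₀U : W₀ ⊆ U := fun x hx => hx.1
  have hW₀t : ∀ x ∈ W₀, ⟪cross (x - x₀) (gradient T x), ℓ⟫ ≠ 0 := fun x hx => by
    rw [inner_cross_left_eq_inner_cross_right]; exact hx.2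
  have hW₀reg : ∀ x ∈ W₀, cross (gradient T x) (x - x₀) ≠ 0 := fun x hx h0 => by
    apply hW₀t x hx
    rw [NetFlux.cross_swap, h0, neg_zero, inner_zero_left]
  have hgradc : ContinuousOn (gradient T) U := by
    have e : gradient T = fun x => (InnerProductSpace.toDual ℝ E3).symm (fderiv ℝ T x) := rfl
    rw [e]
    exact (InnerProductSpace.toDual ℝ E3).symm.continuous.comp_continuousOn
      (hT.continuousOn_fderiv_of_isOpen hUo (by simp))
  have hW₀o : IsOpen W₀ := by
    have hc : ContinuousOn (fun x => ⟪x - x₀, cross (gradient T x) ℓ⟫) U := by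
      have hcr : ContinuousOn (fun x => (crossCLM.flip ℓ) (gradient T x)) U :=
        (crossCLM.flip ℓ).continuous.comp_continuousOn hgradc
      have hsub : Continuous fun x : E3 => x - x₀ := continuous_id.sub continuous_const
      exact (hsub.continuousOn.inner hcr).congr fun x _ => by
        simp only [ContinuousLinearMap.flip_apply, crossCLM_apply]
    exact hc.isOpen_inter_preimage hUo isOpen_compl_singleton
  have hzW₀ : z ∈ W₀ := by
    refine ⟨hzU, ?_⟩
    show ⟪z - x₀, cross (gradient T z) ℓ⟫ ∈ ({0}ᶜ : Set ℝ)
    rw [mem_compl_singleton_iff, ← inner_cross_left_eq_inner_cross_right, NetFlux.cross_swap, hℓ.symm, inner_neg_left,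
      neg_ne_zero, real_inner_self_eq_norm_sq]
    exact pow_ne_zero 2 (norm_ne_zero_iff.2 hℓ0)
  -- the open partial homeomorphism of the inverse function theorem at `z`
  obtain ⟨e, he⟩ := exists_equiv_of_injective (L z) (injective_chartDeriv ℓ (hW₀t z hzW₀))
  have hFz : HasFDerivAt F (e : E3 →L[ℝ] ℝ × ℝ × ℝ) z := by rw [he]; exact hFd z hzU
  have hFcz : ContDiffAt ℝ ∞ F z := hFc z hzU
  have hne : (∞ : WithTop ℕ∞) ≠ 0 := by simp
  obtain ⟨Φ, hΦF, hzs, hFzt⟩ : ∃ Φ : OpenPartialHomeomorph E3 (ℝ × ℝ × ℝ),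
      (Φ : E3 → ℝ × ℝ × ℝ) = F ∧ z ∈ Φ.source ∧ F z ∈ Φ.target :=
    ⟨hFcz.toOpenPartialHomeomorph F hFz hne, ContDiffAt.toOpenPartialHomeomorph_coe hFcz hFz hne,
      ContDiffAt.mem_toOpenPartialHomeomorph_source hFcz hFz hne,
      ContDiffAt.image_mem_toOpenPartialHomeomorph_target hFcz hFz hne⟩
  have hsymm_z : Φ.symm (F z) = z := by rw [← hΦF]; exact Φ.left_inv hzs
  -- a ball around `F z` in the target over which `Φ.symm` lands in `W₀`
  have hN : ∀ᶠ a in 𝓝 (F z), a ∈ Φ.target ∧ Φ.symm a ∈ W₀ := by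
    exact Filter.Eventually.and (Φ.open_target.mem_nhds hFzt)
      ((Φ.continuousAt_symm hFzt).preimage_mem_nhds (by rw [hsymm_z]; exact hW₀o.mem_nhds hzW₀))
  obtain ⟨ε, hε, hball⟩ := Metric.eventually_nhds_iff_ball.1 hN
  set r : ℝ := ‖z - x₀‖ with hr
  have hFz_eq : F z = (r ^ 2, T z, 0) := by
    simp only [hF, hr, hℓ, Tao2016.inner_cross_self_right]
  -- points of the target ball and their preimages
  have hpt : ∀ a ∈ Metric.ball (F z) ε, Φ.symm a ∈ Φ.source ∧ Φ.symm a ∈ W₀ ∧ F (Φ.symm a) = a := by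
    intro a ha
    obtain ⟨ht, hW⟩ := hball a ha
    exact ⟨Φ.map_target ht, hW, by rw [← hΦF]; exact Φ.right_inv ht⟩
  -- `Φ.symm` is `C^∞` at every point of the ball, with derivative the inverse of the chart derivative
  have hsymm_smooth : ∀ a ∈ Metric.ball (F z) ε, ContDiffAt ℝ ∞ Φ.symm a ∧
      ∃ D : ℝ × ℝ × ℝ →L[ℝ] E3, HasFDerivAt Φ.symm D a ∧
        ⟪Φ.symm a - x₀, D (0, 0, 1)⟫ = 0 ∧ fderiv ℝ T (Φ.symm a) (D (0, 0, 1)) = 0 := by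
    intro a ha
    obtain ⟨ht, hW⟩ := hball a ha
    set x := Φ.symm a with hx
    obtain ⟨ex, hex⟩ := exists_equiv_of_injective (L x) (injective_chartDeriv ℓ (hW₀t x hW))
    have hFx : HasFDerivAt Φ (ex : E3 →L[ℝ] ℝ × ℝ × ℝ) (Φ.symm a) := by
      rw [hΦF, hex]; exact hFd x (hW₀U hW)
    have hsm : ContDiffAt ℝ ∞ Φ.symm a := Φ.contDiffAt_symm ht hFx (by rw [hΦF]; exact hFc x (hW₀U hW))
    have hD := Φ.hasFDerivAt_symm ht hFx
    have h3 := hLapply x (ex.symm (0, 0, 1))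
    rw [← hex, ContinuousLinearEquiv.coe_coe, ex.apply_symm_apply, Prod.mk.injEq, Prod.mk.injEq] at h3
    refine ⟨hsm, (ex.symm : ℝ × ℝ × ℝ →L[ℝ] E3), hD, ?_, ?_⟩ <;> rw [ContinuousLinearEquiv.coe_coe]
    · linarith [h3.1]
    · exact h3.2.1.symm
  -- the chart function `N = m ∘ Φ.symm` and its `u`-independence
  set N : ℝ × ℝ × ℝ → ℝ := fun a => m (Φ.symm a) with hNdef
  have hNu : ∀ a ∈ Metric.ball (F z) ε, HasDerivAt (fun t : ℝ => N (a.1, a.2.1, t)) 0 a.2.2 := by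
    intro a ha
    obtain ⟨hsm, D, hD, h1, h2⟩ := hsymm_smooth a ha
    obtain ⟨-, hW, -⟩ := hpt a ha
    have hγ : HasDerivAt (fun t : ℝ => ((a.1, a.2.1, t) : ℝ × ℝ × ℝ)) ((0, 0, 1) : ℝ × ℝ × ℝ) a.2.2 :=
      (hasDerivAt_const _ a.1).prodMk ((hasDerivAt_const _ a.2.1).prodMk (hasDerivAt_id a.2.2))
    have ha' : ((a.1, a.2.1, a.2.2) : ℝ × ℝ × ℝ) = a := rfl
    have hD' : HasFDerivAt Φ.symm D (a.1, a.2.1, a.2.2) := by rw [ha']; exact hD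
    have hcomp := hD'.comp_hasDerivAt a.2.2 hγ
    have hmd' : DifferentiableAt ℝ m (Φ.symm (a.1, a.2.1, a.2.2)) := by rw [ha']; exact hmd _ (hW₀U hW)
    have hfull := hmd'.hasFDerivAt.comp_hasDerivAt a.2.2 hcomp
    -- `⟪∇m, τ_u⟫ = 0`: `τ_u ⊥ x − x₀`, `τ_u ⊥ ∇T`, and `⟪∇m, ∇T × (x − x₀)⟫ = −⟪x − x₀, ∇m × ∇T⟫ = 0`
    have hval : fderiv ℝ m (Φ.symm (a.1, a.2.1, a.2.2)) (D (0, 0, 1)) = 0 := by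
      rw [ha', ← inner_gradient_left (𝕜 := ℝ)]
      have hx0 : ⟪Φ.symm a - x₀, D (0, 0, 1)⟫ = 0 := h1
      have hT0 : ⟪gradient T (Φ.symm a), D (0, 0, 1)⟫ = 0 := by rw [inner_gradient_left (𝕜 := ℝ)]; exact h2
      have hg : ⟪gradient m (Φ.symm a), cross (gradient T (Φ.symm a)) (Φ.symm a - x₀)⟫ = 0 := by
        have h := hdet (Φ.symm a) (hW₀U hW)
        rw [real_inner_comm] at h
        rwa [inner_cross_left_eq_inner_cross_right] at h
      exact inner_eq_zero_of_orthogonal_pair (hW₀reg _ hW) hT0 hx0 hg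
    rw [hval] at hfull
    exact hfull
  -- geometry of the target ball (sup metric on `ℝ × ℝ × ℝ`)
  have hball_iff : ∀ q c u : ℝ, ((q, c, u) : ℝ × ℝ × ℝ) ∈ Metric.ball (F z) ε ↔
      |q - r ^ 2| < ε ∧ |c - T z| < ε ∧ |u| < ε := by
    intro q c u
    rw [Metric.mem_ball, hFz_eq, Prod.dist_eq, Prod.dist_eq, Real.dist_eq, Real.dist_eq, Real.dist_eq, sub_zero,
      max_lt_iff, max_lt_iff]
  -- (2) `N(q, c, u) = N(q, c, 0)` on the ball (mean value inequality in `u`)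
  have hNconst : ∀ a ∈ Metric.ball (F z) ε, N a = N (a.1, a.2.1, 0) := by
    intro a ha
    have ha' : ((a.1, a.2.1, a.2.2) : ℝ × ℝ × ℝ) ∈ Metric.ball (F z) ε := ha
    obtain ⟨hq, hc, hu⟩ := (hball_iff _ _ _).1 ha'
    have hseg : ∀ t ∈ uIcc (0 : ℝ) a.2.2, ((a.1, a.2.1, t) : ℝ × ℝ × ℝ) ∈ Metric.ball (F z) ε := by
      intro t ht
      refine (hball_iff _ _ _).2 ⟨hq, hc, lt_of_le_of_lt ?_ hu⟩
      have h1 := Set.abs_sub_left_of_mem_uIcc ht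
      simpa using h1
    have hmv := Convex.norm_image_sub_le_of_norm_hasDerivWithin_le (f := fun t : ℝ => N (a.1, a.2.1, t))
      (f' := fun _ => (0 : ℝ)) (C := 0) (s := uIcc (0 : ℝ) a.2.2)
      (fun t ht => (hNu (a.1, a.2.1, t) (hseg t ht)).hasDerivWithinAt) (fun t _ => by simp) (convex_uIcc 0 a.2.2)
      left_mem_uIcc right_mem_uIcc
    rw [zero_mul, norm_le_zero_iff, sub_eq_zero] at hmv
    exact hmv
  -- (3) smoothness of `(q, c) ↦ N(q, c, 0)` on the box
  have hM₂ : ∀ p : ℝ × ℝ, |p.1 - r ^ 2| < ε → |p.2 - T z| < ε →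
      ContDiffAt ℝ ∞ (fun p : ℝ × ℝ => N (p.1, p.2, 0)) p := by
    intro p h1 h2
    have ha : ((p.1, p.2, (0 : ℝ)) : ℝ × ℝ × ℝ) ∈ Metric.ball (F z) ε := (hball_iff _ _ _).2 ⟨h1, h2, by simpa using hε⟩
    obtain ⟨hsm, -⟩ := hsymm_smooth _ ha
    obtain ⟨-, hW, -⟩ := hpt _ ha
    have hemb : ContDiff ℝ ∞ (fun p : ℝ × ℝ => ((p.1, p.2, (0 : ℝ)) : ℝ × ℝ × ℝ)) :=
      contDiff_fst.prodMk (contDiff_snd.prodMk contDiff_const)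
    have h1 : ContDiffAt ℝ ∞ (fun p : ℝ × ℝ => Φ.symm (p.1, p.2, 0)) p := hsm.comp p hemb.contDiffAt
    exact (hmc _ (hW₀U hW)).comp p h1
  -- (4) globalisation by a product of bump functions equal to `1` near `(r², T z)`
  let χ₁ : ContDiffBump (r ^ 2) := ⟨ε / 2, 3 * ε / 4, by positivity, by linarith⟩
  let χ₂ : ContDiffBump (T z) := ⟨ε / 2, 3 * ε / 4, by positivity, by linarith⟩
  set M₂ : ℝ → ℝ → ℝ := fun q c => χ₁ q * χ₂ c * N (q, c, 0) with hM₂def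
  have hM₂smooth : ContDiff ℝ ∞ (Function.uncurry M₂) := by
    rw [contDiff_iff_contDiffAt]
    intro p
    by_cases hp : |p.1 - r ^ 2| < ε ∧ |p.2 - T z| < ε
    · exact (((χ₁.contDiff.comp contDiff_fst).mul (χ₂.contDiff.comp contDiff_snd)).contDiffAt).mul (hM₂ p hp.1 hp.2)
    · rw [not_and_or, not_lt, not_lt] at hp
      have hev : Function.uncurry M₂ =ᶠ[𝓝 p] fun _ => 0 := by
        rcases hp with h | h
        · have hopen : IsOpen {p' : ℝ × ℝ | 3 * ε / 4 < dist p'.1 (r ^ 2)} :=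
            isOpen_lt continuous_const (continuous_fst.dist continuous_const)
          have hmem : p ∈ {p' : ℝ × ℝ | 3 * ε / 4 < dist p'.1 (r ^ 2)} := by
            simp only [mem_setOf_eq, Real.dist_eq]; linarith
          filter_upwards [hopen.mem_nhds hmem] with p' hp'
          simp [hM₂def, Function.uncurry, χ₁.zero_of_le_dist (le_of_lt hp')]
        · have hopen : IsOpen {p' : ℝ × ℝ | 3 * ε / 4 < dist p'.2 (T z)} :=
            isOpen_lt continuous_const (continuous_snd.dist continuous_const)
          have hmem : p ∈ {p' : ℝ × ℝ | 3 * ε / 4 < dist p'.2 (T z)} := by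
            simp only [mem_setOf_eq, Real.dist_eq]; linarith
          filter_upwards [hopen.mem_nhds hmem] with p' hp'
          simp [hM₂def, Function.uncurry, χ₂.zero_of_le_dist (le_of_lt hp')]
      exact contDiffAt_const.congr_of_eventuallyEq hev
  -- (5) the neighbourhood `V` and the function `M(a, b) = M₂(b², a)`
  set V : Set E3 := (Φ.source ∩ U) ∩ (fun x => (‖x - x₀‖ ^ 2, T x, ⟪ℓ, x - x₀⟫)) ⁻¹'
    (Metric.ball (r ^ 2) (ε / 2) ×ˢ Metric.ball (T z) (ε / 2) ×ˢ Metric.ball (0 : ℝ) (ε / 2)) with hVdef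
  have hVo : IsOpen V := by
    have hc : ContinuousOn (fun x => (‖x - x₀‖ ^ 2, T x, ⟪ℓ, x - x₀⟫)) (Φ.source ∩ U) :=
      fun x hx => (hFc x hx.2).continuousAt.continuousWithinAt
    exact hc.isOpen_inter_preimage (Φ.open_source.inter hUo)
      (Metric.isOpen_ball.prod (Metric.isOpen_ball.prod Metric.isOpen_ball))
  have hzV : z ∈ V := by
    refine ⟨⟨hzs, hzU⟩, ?_⟩
    show (‖z - x₀‖ ^ 2, T z, ⟪ℓ, z - x₀⟫) ∈
      Metric.ball (r ^ 2) (ε / 2) ×ˢ Metric.ball (T z) (ε / 2) ×ˢ Metric.ball (0 : ℝ) (ε / 2)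
    rw [← hr, hℓ, Tao2016.inner_cross_self_right]
    exact ⟨Metric.mem_ball_self (by positivity), Metric.mem_ball_self (by positivity), Metric.mem_ball_self (by positivity)⟩
  refine ⟨V, hVo, hzV, fun x hx => hx.1.2, fun a b => M₂ (b ^ 2) a, ?_, fun x hx => ?_⟩
  · have hsw : ContDiff ℝ ∞ (fun ab : ℝ × ℝ => ((ab.2 ^ 2, ab.1) : ℝ × ℝ)) :=
      (contDiff_snd.pow 2).prodMk contDiff_fst
    exact hM₂smooth.comp hsw
  · obtain ⟨⟨hxs, hxU⟩, hxB⟩ := hx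
    have hxB' : (‖x - x₀‖ ^ 2, T x, ⟪ℓ, x - x₀⟫) ∈
        Metric.ball (r ^ 2) (ε / 2) ×ˢ Metric.ball (T z) (ε / 2) ×ˢ Metric.ball (0 : ℝ) (ε / 2) := hxB
    simp only [mem_prod, Metric.mem_ball, Real.dist_eq, sub_zero] at hxB'
    obtain ⟨h1, h2, h3⟩ := hxB'
    have hFx : F x ∈ Metric.ball (F z) ε :=
      (hball_iff _ _ _).2 ⟨by linarith, by linarith, by linarith⟩
    have hsx : Φ.symm (F x) = x := by rw [← hΦF]; exact Φ.left_inv hxs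
    have hq1 : χ₁ (‖x - x₀‖ ^ 2) = 1 :=
      χ₁.one_of_mem_closedBall (by rw [Metric.mem_closedBall, Real.dist_eq, show χ₁.rIn = ε / 2 from rfl]; linarith)
    have hc1 : χ₂ (T x) = 1 :=
      χ₂.one_of_mem_closedBall (by rw [Metric.mem_closedBall, Real.dist_eq, show χ₂.rIn = ε / 2 from rfl]; linarith)
    calc m x = N (F x) := by simp only [hNdef, hsx]
      _ = N (‖x - x₀‖ ^ 2, T x, 0) := hNconst _ hFx
      _ = M₂ (‖x - x₀‖ ^ 2) (T x) := by simp only [hM₂def, hq1, hc1, one_mul]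

end LevelSetLocalLaw

end Summit.NavierStokesRegularity.NavierStokesRegularity.Theorems.PoloidalLiouville

end
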